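import Summits.BirchSwinnertonDyer.BirchSwinnertonDyer.Theorems.UniversalToricDescentCharIdealVacuity
import Literature.NumberTheory.EllipticCurves.UnrIntegersUnits
import Summits.BirchSwinnertonDyer.Rank1Residual.X11b.HalvesReceptacle
import HarnessLib

/-!
# Off the torsion locus the EQUALITY / NORM-PROFILE halves read "the frame is a unit" — statement audit
# for `InvariantsTransportModThree` (stmt-BirchSwinnertonDyer-20399) and `ToricTransportModThree` (20186)

Lead prover bsd-wall-utd-p1 g4 (`--supports stmt-BirchSwinnertonDyer-20399`, helper; companion of
`UniversalToricDescentCharIdealVacuity`, p543904). That file proved: if the anticyclotomic Selmer dual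
`X = AcSelmer.XAc W p κ 𝔭′ S γ` is NOT a torsion `Λ`-module then `Ch_Λ(X) = ⊤`, so an INCLUSION-shaped
conclusion `(L) ⊆ Ch·R₀⟦T⟧` (child 20395) is vacuous there. THIS FILE reads the two OTHER shapes used by the
split of crux #2 off the torsion locus — they are NOT vacuous but say something else than intended:

* EQUALITY shape (parent 20186 `ToricTransportModThree`, crux #3 `TwinSplitIMCAtThree`):
  `Ch·R₀⟦T⟧ = (L)` with `Ch = ⊤` holds iff `L` is a UNIT of `R₀⟦T⟧`, i.e. iff `‖L(𝟙)‖ = ‖[T⁰]L‖ = 1`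
  (`map_xacCharIdeal_eq_span_iff_isUnit_of_not_isTorsion`);
* NORM-PROFILE shape (child 20399 `InvariantsTransportModThree`: `∃ g n, Ch·R₀⟦T⟧ = (g)`, `g` and `L` with
  no norm-one coefficient below `n` and one at `n`): with `Ch = ⊤` it holds iff `L` is a unit
  (`exists_generator_normProfile_iff_isUnit_of_not_isTorsion`; the generator is forced to be a unit, so
  `n = 0`).

Contrapositives (`isTorsion_of_map_xacCharIdeal_eq_span_of_not_isUnit`,
`isTorsion_of_exists_generator_normProfile_of_not_isUnit`): at every datum carrying a NON-UNIT frame `L`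
(`‖L(𝟙)‖ < 1`; under crux #4 `L(𝟙) = u·(log_ω P/c)²`, so: whenever `log_ω P/c` is not a `3`-adic unit) the
conclusions of 20399 and of 20186 each IMPLY that `X_{∅,0}(E/K_∞)` is `Λ`-torsion. So, as typed, the
`Λ`-torsion of `X_{∅,0}(E/K_∞)` at the additive split prime — beyond print, part of the wall — is asserted by
20399 (and by the parent) implicitly, and by 20395 not at all. T11 of the cell's TYPING-CHECKLIST v1.3
("what does the statement say when the module is free of rank 1?") answered for all three children.

* §1 (pure algebra in `R₀⟦T⟧`): `isUnit_iff_norm_constantCoeff_eq_one`, `top_eq_span_singleton_iff_isUnit`,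
  `exists_generator_normProfile_top_iff_isUnit`.
* §2 (the `X_ac` reading, any curve / prime / `Σ`): the four theorems above.

THEOREMS ONLY; no definition, no named fact, no `sorry`; imports no `Theses` module.
References: [Washington1997] §13.2 (characteristic ideals of torsion Λ-modules), §7.1 (units of `𝒪⟦T⟧`);
[Castella2018] Thm. 2.3 (the torsion hypothesis behind `Ch_Λ(X_ac)`), §3 (the receptacle `R₀⟦T⟧`).
-/

noncomputable section

open scoped Classical

set_option linter.dupNamespace false
set_option autoImplicit false

namespace Summit.BirchSwinnertonDyer.BirchSwinnertonDyer.Theorems.UniversalToricDescentOffTorsionUnitFrames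

open Literature.NumberTheory.EllipticCurves

/-! ### §1 Algebra in `R₀⟦T⟧`: the two shapes at the unit ideal -/

section Algebra

variable {p : ℕ} [Fact p.Prime]

/-- `L ∈ R₀⟦T⟧` is a unit iff its constant term `L(𝟙) = [T⁰]L` has norm `1` in `ℂ_p` (a power series is a
unit iff its constant term is; `R₀ˣ = {‖·‖ = 1}`). [cite: Washington1997, §7.1] -/
theorem isUnit_iff_norm_constantCoeff_eq_one (L : UnrSeries p) :
    IsUnit L ↔ ‖((PowerSeries.constantCoeff L : unrIntegers p) : ℂ_[p])‖ = 1 := by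
  rw [PowerSeries.isUnit_iff_constantCoeff, unrIntegers.isUnit_iff_norm_eq_one]

/-- EQUALITY shape at the unit ideal: `⊤ = (L)` iff `L` is a unit. [cite: Washington1997, §7.1] -/
theorem top_eq_span_singleton_iff_isUnit (L : UnrSeries p) :
    (⊤ : Ideal (UnrSeries p)) = Ideal.span {L} ↔ IsUnit L := by
  rw [eq_comm, Ideal.span_singleton_eq_top]

/-- NORM-PROFILE shape at the unit ideal: "`⊤ = (g)` for some `g` such that `g` and `L` have no norm-one
coefficient below `n` and a norm-one coefficient at `n`" iff `L` is a unit (then `g` is a unit, which forces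
`n = 0`, and `‖[T⁰]L‖ = 1`; conversely take `g = 1`, `n = 0`). [cite: Washington1997, §7.1] -/
theorem exists_generator_normProfile_top_iff_isUnit (L : UnrSeries p) :
    (∃ (g : UnrSeries p) (n : ℕ), (⊤ : Ideal (UnrSeries p)) = Ideal.span {g} ∧
        (∀ i < n, ‖((PowerSeries.coeff i g : unrIntegers p) : ℂ_[p])‖ < 1) ∧
        ‖((PowerSeries.coeff n g : unrIntegers p) : ℂ_[p])‖ = 1 ∧
        (∀ i < n, ‖((PowerSeries.coeff i L : unrIntegers p) : ℂ_[p])‖ < 1) ∧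
        ‖((PowerSeries.coeff n L : unrIntegers p) : ℂ_[p])‖ = 1) ↔ IsUnit L := by
  constructor
  · rintro ⟨g, n, htop, hg, -, -, hLn⟩
    have hgu : IsUnit g := Ideal.span_singleton_eq_top.mp htop.symm
    have hg0 : ‖((PowerSeries.constantCoeff g : unrIntegers p) : ℂ_[p])‖ = 1 :=
      (isUnit_iff_norm_constantCoeff_eq_one g).mp hgu
    obtain rfl : n = 0 := by
      by_contra hn
      have h0 := hg 0 (Nat.pos_of_ne_zero hn)
      rw [PowerSeries.coeff_zero_eq_constantCoeff_apply] at h0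
      exact absurd hg0 (ne_of_lt h0)
    rw [PowerSeries.coeff_zero_eq_constantCoeff_apply] at hLn
    exact (isUnit_iff_norm_constantCoeff_eq_one L).mpr hLn
  · intro hL
    refine ⟨1, 0, ?_, fun i hi ↦ absurd hi (Nat.not_lt_zero i), ?_,
      fun i hi ↦ absurd hi (Nat.not_lt_zero i), ?_⟩
    · rw [Ideal.span_singleton_one]
    · rw [PowerSeries.coeff_zero_eq_constantCoeff_apply, map_one, OneMemClass.coe_one, norm_one]
    · rw [PowerSeries.coeff_zero_eq_constantCoeff_apply]
      exact (isUnit_iff_norm_constantCoeff_eq_one L).mp hL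

end Algebra

/-! ### §2 The `X_ac` reading (currency of 20186 / 20399 / 20214) -/

section XAc

open NumberField IsDedekindDomain Field Summit.BirchSwinnertonDyer.Rank1Residual.X11b

variable {K : Type} [Field K] [NumberField K] (W : WeierstrassCurve K) (p : ℕ) [Fact p.Prime]
  (κ : ZpExtension K p) (𝔭' : HeightOneSpectrum (𝓞 K)) (S : Finset (HeightOneSpectrum (𝓞 K)))
  (γ : Field.absoluteGaloisGroup K) [Fact (κ.IsTopGenerator γ)]

/-- **EQUALITY shape off the torsion locus = "the frame is a unit".** If `X_ac^S = AcSelmer.XAc W p κ 𝔭′ S γ`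
is NOT `Λ`-torsion, then `Ch_Λ(X_ac^S)·R₀⟦T⟧ = (L)` iff `L ∈ R₀⟦T⟧ˣ` (the left side is `⊤`,
`UniversalToricDescentCharIdealVacuity.xacCharIdeal_eq_top_of_not_isTorsion`). The conclusion shape of
20186 `ToricTransportModThree` and of 20214 `TwinSplitIMCAtThree` (ii).
[cite: Castella2018, Thm. 2.3 (arXiv:1704.06608 p. 5) (the torsion hypothesis behind Ch_Λ(X_ac))] -/
theorem map_xacCharIdeal_eq_span_iff_isUnit_of_not_isTorsion
    (h : ¬ Module.IsTorsion (IwasawaAlgebra p) (AcSelmer.XAc W p κ 𝔭' S γ)) (L : UnrSeries p) :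
    (AcSelmer.XAc.charIdeal W p κ 𝔭' S γ).map (PowerSeries.map (Halves.toUnr p)) = Ideal.span {L} ↔
      IsUnit L := by
  rw [UniversalToricDescentCharIdealVacuity.xacCharIdeal_eq_top_of_not_isTorsion W p κ 𝔭' S γ h,
    Ideal.map_top]
  exact top_eq_span_singleton_iff_isUnit L

/-- Contrapositive: **an equality `Ch_Λ(X_ac^S)·R₀⟦T⟧ = (L)` at a NON-UNIT `L` forces `X_ac^S` to be
`Λ`-torsion.** So 20186's conclusion (and 20214 (ii)) at a frame with `‖L(𝟙)‖ < 1` carries the torsion claim.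
[cite: Castella2018, Thm. 2.3 (arXiv:1704.06608 p. 5) (the torsion hypothesis behind Ch_Λ(X_ac))] -/
theorem isTorsion_of_map_xacCharIdeal_eq_span_of_not_isUnit {L : UnrSeries p} (hL : ¬ IsUnit L)
    (h : (AcSelmer.XAc.charIdeal W p κ 𝔭' S γ).map (PowerSeries.map (Halves.toUnr p)) =
      Ideal.span {L}) :
    Module.IsTorsion (IwasawaAlgebra p) (AcSelmer.XAc W p κ 𝔭' S γ) := by
  by_contra hT
  exact hL ((map_xacCharIdeal_eq_span_iff_isUnit_of_not_isTorsion W p κ 𝔭' S γ hT L).mp h)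

/-- **NORM-PROFILE shape off the torsion locus = "the frame is a unit".** If `X_ac^S` is NOT `Λ`-torsion,
the conclusion predicate of 20399 `InvariantsTransportModThree` — "`Ch_Λ(X_ac^S)·R₀⟦T⟧ = (g)` with `g` and
`L` of the same norm profile `(μ, λ) = (0, n)`" — holds iff `L ∈ R₀⟦T⟧ˣ` (and then `n = 0`). Not vacuous:
it fails at every non-unit frame. [cite: GreenbergVatsal2000, §1 (the (μ, λ) currency)]
[cite: Castella2018, Thm. 2.3 (arXiv:1704.06608 p. 5) (the torsion hypothesis behind Ch_Λ(X_ac))] -/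
theorem exists_generator_normProfile_iff_isUnit_of_not_isTorsion
    (h : ¬ Module.IsTorsion (IwasawaAlgebra p) (AcSelmer.XAc W p κ 𝔭' S γ)) (L : UnrSeries p) :
    (∃ (g : UnrSeries p) (n : ℕ),
        (AcSelmer.XAc.charIdeal W p κ 𝔭' S γ).map (PowerSeries.map (Halves.toUnr p)) =
          Ideal.span {g} ∧
        (∀ i < n, ‖((PowerSeries.coeff i g : unrIntegers p) : ℂ_[p])‖ < 1) ∧
        ‖((PowerSeries.coeff n g : unrIntegers p) : ℂ_[p])‖ = 1 ∧
        (∀ i < n, ‖((PowerSeries.coeff i L : unrIntegers p) : ℂ_[p])‖ < 1) ∧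
        ‖((PowerSeries.coeff n L : unrIntegers p) : ℂ_[p])‖ = 1) ↔ IsUnit L := by
  rw [UniversalToricDescentCharIdealVacuity.xacCharIdeal_eq_top_of_not_isTorsion W p κ 𝔭' S γ h,
    Ideal.map_top]
  exact exists_generator_normProfile_top_iff_isUnit L

/-- Contrapositive: **20399's conclusion at a NON-UNIT frame `L` forces `X_ac^S` to be `Λ`-torsion** — as
typed, the `Λ`-torsion of `X_{∅,0}(E/K_∞)` at the additive split prime rides on child 20399 (and on the
parent 20186), not on the wall child 20395 (vacuous there, p543904).
[cite: GreenbergVatsal2000, §1 (the (μ, λ) currency)]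
[cite: Castella2018, Thm. 2.3 (arXiv:1704.06608 p. 5) (the torsion hypothesis behind Ch_Λ(X_ac))] -/
theorem isTorsion_of_exists_generator_normProfile_of_not_isUnit {L : UnrSeries p} (hL : ¬ IsUnit L)
    (h : ∃ (g : UnrSeries p) (n : ℕ),
        (AcSelmer.XAc.charIdeal W p κ 𝔭' S γ).map (PowerSeries.map (Halves.toUnr p)) =
          Ideal.span {g} ∧
        (∀ i < n, ‖((PowerSeries.coeff i g : unrIntegers p) : ℂ_[p])‖ < 1) ∧
        ‖((PowerSeries.coeff n g : unrIntegers p) : ℂ_[p])‖ = 1 ∧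
        (∀ i < n, ‖((PowerSeries.coeff i L : unrIntegers p) : ℂ_[p])‖ < 1) ∧
        ‖((PowerSeries.coeff n L : unrIntegers p) : ℂ_[p])‖ = 1) :
    Module.IsTorsion (IwasawaAlgebra p) (AcSelmer.XAc W p κ 𝔭' S γ) := by
  by_contra hT
  exact hL ((exists_generator_normProfile_iff_isUnit_of_not_isTorsion W p κ 𝔭' S γ hT L).mp h)

/-- The unit test in the frame's own terms: `L ∈ R₀⟦T⟧ˣ ↔ ‖[T⁰]L‖ = 1` (value at the trivial character).
Restated in §2's namespace for consumers. [cite: Washington1997, §7.1] -/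
theorem not_isUnit_of_norm_constantCoeff_lt_one {L : UnrSeries p}
    (hL : ‖((PowerSeries.constantCoeff L : unrIntegers p) : ℂ_[p])‖ < 1) : ¬ IsUnit L := fun hu ↦
  absurd ((isUnit_iff_norm_constantCoeff_eq_one L).mp hu) (ne_of_lt hL)

end XAc

/-! ### §3 The same readings with the imprimitivity set typed as a `Set` (appended, utd-p1 g4)

The route items quantify `AcSelmer.XAc (W.baseChange K) 3 κ 𝔭′ ∅ γ` with `∅ : Set _` (the binder `S` of
`AcSelmer.XAc` is a `Set`), whereas §2 (like `UniversalToricDescentCharIdealVacuity`) took `S : Finset _`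
coerced. For by-name consumers the four readings are restated for an arbitrary `S : Set _`, proved directly from
the general algebra (`UniversalToricDescentCharIdealVacuity.charIdeal_eq_top_of_not_isTorsion`, which gives
`Ch_Λ(X_ac^S) = ⊤` and the vacuity of the INCLUSION shape for any `S` as it stands). -/

section XAcSet

open NumberField IsDedekindDomain Field Summit.BirchSwinnertonDyer.Rank1Residual.X11b

variable {K : Type} [Field K] [NumberField K] (W : WeierstrassCurve K) (p : ℕ) [Fact p.Prime]
  (κ : ZpExtension K p) (𝔭' : HeightOneSpectrum (𝓞 K)) (S : Set (HeightOneSpectrum (𝓞 K)))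
  (γ : Field.absoluteGaloisGroup K) [Fact (κ.IsTopGenerator γ)]

/-- EQUALITY shape off the torsion locus = "the frame is a unit" (`Set` form of
`map_xacCharIdeal_eq_span_iff_isUnit_of_not_isTorsion`).
[cite: Castella2018, Thm. 2.3 (arXiv:1704.06608 p. 5) (the torsion hypothesis behind Ch_Λ(X_ac))] -/
theorem map_xacCharIdeal_eq_span_iff_isUnit_of_not_isTorsion_set
    (h : ¬ Module.IsTorsion (IwasawaAlgebra p) (AcSelmer.XAc W p κ 𝔭' S γ)) (L : UnrSeries p) :
    (AcSelmer.XAc.charIdeal W p κ 𝔭' S γ).map (PowerSeries.map (Halves.toUnr p)) = Ideal.span {L} ↔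
      IsUnit L := by
  rw [show AcSelmer.XAc.charIdeal W p κ 𝔭' S γ = ⊤ from
      UniversalToricDescentCharIdealVacuity.charIdeal_eq_top_of_not_isTorsion h, Ideal.map_top]
  exact top_eq_span_singleton_iff_isUnit L

/-- An equality `Ch_Λ(X_ac^S)·R₀⟦T⟧ = (L)` at a NON-UNIT `L` forces `X_ac^S` to be `Λ`-torsion (`Set` form
of `isTorsion_of_map_xacCharIdeal_eq_span_of_not_isUnit`).
[cite: Castella2018, Thm. 2.3 (arXiv:1704.06608 p. 5) (the torsion hypothesis behind Ch_Λ(X_ac))] -/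
theorem isTorsion_of_map_xacCharIdeal_eq_span_of_not_isUnit_set {L : UnrSeries p} (hL : ¬ IsUnit L)
    (h : (AcSelmer.XAc.charIdeal W p κ 𝔭' S γ).map (PowerSeries.map (Halves.toUnr p)) =
      Ideal.span {L}) :
    Module.IsTorsion (IwasawaAlgebra p) (AcSelmer.XAc W p κ 𝔭' S γ) := by
  by_contra hT
  exact hL ((map_xacCharIdeal_eq_span_iff_isUnit_of_not_isTorsion_set W p κ 𝔭' S γ hT L).mp h)

/-- NORM-PROFILE shape (child 20399) off the torsion locus = "the frame is a unit" (`Set` form of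
`exists_generator_normProfile_iff_isUnit_of_not_isTorsion`). [cite: GreenbergVatsal2000, §1 (the (μ, λ) currency)]
[cite: Castella2018, Thm. 2.3 (arXiv:1704.06608 p. 5) (the torsion hypothesis behind Ch_Λ(X_ac))] -/
theorem exists_generator_normProfile_iff_isUnit_of_not_isTorsion_set
    (h : ¬ Module.IsTorsion (IwasawaAlgebra p) (AcSelmer.XAc W p κ 𝔭' S γ)) (L : UnrSeries p) :
    (∃ (g : UnrSeries p) (n : ℕ),
        (AcSelmer.XAc.charIdeal W p κ 𝔭' S γ).map (PowerSeries.map (Halves.toUnr p)) =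
          Ideal.span {g} ∧
        (∀ i < n, ‖((PowerSeries.coeff i g : unrIntegers p) : ℂ_[p])‖ < 1) ∧
        ‖((PowerSeries.coeff n g : unrIntegers p) : ℂ_[p])‖ = 1 ∧
        (∀ i < n, ‖((PowerSeries.coeff i L : unrIntegers p) : ℂ_[p])‖ < 1) ∧
        ‖((PowerSeries.coeff n L : unrIntegers p) : ℂ_[p])‖ = 1) ↔ IsUnit L := by
  rw [show AcSelmer.XAc.charIdeal W p κ 𝔭' S γ = ⊤ from
      UniversalToricDescentCharIdealVacuity.charIdeal_eq_top_of_not_isTorsion h, Ideal.map_top]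
  exact exists_generator_normProfile_top_iff_isUnit L

/-- 20399's conclusion at a NON-UNIT frame forces `X_ac^S` to be `Λ`-torsion (`Set` form of
`isTorsion_of_exists_generator_normProfile_of_not_isUnit`). [cite: GreenbergVatsal2000, §1 (the (μ, λ) currency)]
[cite: Castella2018, Thm. 2.3 (arXiv:1704.06608 p. 5) (the torsion hypothesis behind Ch_Λ(X_ac))] -/
theorem isTorsion_of_exists_generator_normProfile_of_not_isUnit_set {L : UnrSeries p} (hL : ¬ IsUnit L)
    (h : ∃ (g : UnrSeries p) (n : ℕ),
        (AcSelmer.XAc.charIdeal W p κ 𝔭' S γ).map (PowerSeries.map (Halves.toUnr p)) =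
          Ideal.span {g} ∧
        (∀ i < n, ‖((PowerSeries.coeff i g : unrIntegers p) : ℂ_[p])‖ < 1) ∧
        ‖((PowerSeries.coeff n g : unrIntegers p) : ℂ_[p])‖ = 1 ∧
        (∀ i < n, ‖((PowerSeries.coeff i L : unrIntegers p) : ℂ_[p])‖ < 1) ∧
        ‖((PowerSeries.coeff n L : unrIntegers p) : ℂ_[p])‖ = 1) :
    Module.IsTorsion (IwasawaAlgebra p) (AcSelmer.XAc W p κ 𝔭' S γ) := by
  by_contra hT
  exact hL ((exists_generator_normProfile_iff_isUnit_of_not_isTorsion_set W p κ 𝔭' S γ hT L).mp h)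

end XAcSet

end Summit.BirchSwinnertonDyer.BirchSwinnertonDyer.Theorems.UniversalToricDescentOffTorsionUnitFrames

end
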